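import Literature.Computability.AlgebraicComplexity.EGOW2018Restatement
import Literature.Computability.AlgebraicComplexity.BasicTensorSubspaces
import Mathlib.Algebra.Order.Antidiag.FinsuppEquiv
import Mathlib.Logic.Equiv.Fintype
import HarnessLib

/-!
# EGOW 2018 §5 — the entry space of the depth-3 instantiation is `SSM(y)`
(cell val-lit, typer t22, DAG row EGOW2018-B; source `paper:arxiv-1710.09502`;
bib `EfremenkoGargOliveiraWigderson2018`)

K. Efremenko, A. Garg, R. Oliveira, A. Wigderson, *Barriers for rank methods in arithmetic
complexity*, ITCS 2018 = arXiv:1710.09502, §5, the claim on p. 15 (chunk `p0015.txt:L58–78` of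
`lit read arxiv:1710.09502`):

"We claim that the space of possible entries of our matrix `L`, denoted as above by
`𝓛 = {ℓ(ψ) : ℓ ∈ F[y][x]_d^*}`, is equal to the space of set symmetric multilinear polynomials of degree
`d` in the variables `y`, which we denote by `SSM(y)`. Note that any `ℓ(ψ)` is a set multilinear
function in `y = (y_1, …, y_D)`, where `y_i = (y_{ij})_{j=1}^{n}` and `ℓ(ψ)` is also set symmetric in the
sense that `ℓ(ψ)(y_1, …, y_D) = ℓ(ψ)(y_{σ(1)}, …, y_{σ(D)})` for every `σ ∈ S_D` … Hence, we have that
`𝓛 ⊆ SSM(y)`. To see that `SSM(y) = 𝓛` we only need to show that `dim(𝓛) = dim(SSM(y))`. … `dim(𝓛)` is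
equal to the dimension of the space of homogeneous polynomials of degree `d` over `x` … the space of
homogeneous polynomials is isomorphic to the space of set symmetric multilinear polynomials by the
following homomorphism `x_{i_1} ⋯ x_{i_d} ↦ ∑_{σ ∈ S_n} ∏_j x_{σ(i_j)}`."

HONEST FRAMING: known linear algebra / combinatorics, typed and proved; `VP ≠ VNP` is NOT proved and
nothing here is progress on it. The cell's first pass (`EGOW2018RankMeasures.lean`, Errata) recorded
that the DISPLAYED symmetrisation map is garbled as printed (it permutes variable indices inside `F[x]`
and does not land in `F[y]`); the CLAIM `𝓛 = SSM(y)` itself is precise and true, and this file proves it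
— together with the dimension count and the corrected symmetrisation statement — for the tree's `ψ`
(`depthThreePsi`) and `𝓛 = entrySpace ψ` (`EGOW2018Restatement.lean`).

## Typing

* `y`-variables `Fin D × Fin n` (`y_{ij} ↔ (i, j)`), blocks `y_i` = fibres of `Prod.fst` (the tree's block
  vocabulary `blockWeight` / `blockProfile` / `transversalMonomial`, `SetMultilinear.lean`,
  `EGOW2018RankMeasures.lean`).
* "set multilinear in `y = (y_1, …, y_D)`" for a polynomial of degree `d ≤ D`: every monomial has degree
  `≤ 1` in every block (`IsBlockMultilinear`; with exactly `d` of the `D` blocks used — forced by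
  homogeneity); "set symmetric": invariant under `y_{ij} ↦ y_{σ(i) j}` for all `σ ∈ S_D`
  (`IsBlockSymmetric`, via `MvPolynomial.rename (Prod.map σ id)`); `SSM(y)` = `ssmSpace F n d D`, the
  subspace of `F[y]` of homogeneous degree-`d` polynomials with both properties.
* `𝓛` = `entrySpace (depthThreePsi F n d D)` (the paper's functionals on `F[x]_d` and ours on `F[x]` give
  the same set: `ψ` is homogeneous of degree `d` in `x`, `coeff_depthThreePsi_eq_zero`).

## What is proved

* `coeff_depthThreePsi`: the coordinates of `ψ` — the `x^m`-coefficient `ψ_m ∈ F[y]` is the sum of the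
  transversal monomials `∏_{i ∈ T} y_{i, g(i)}` over `|T| = d`, `g : T → [n]` with value multiset `m`.
* **`𝓛 ⊆ SSM(y)`** (`entrySpace_depthThreePsi_le_ssmSpace`; symmetry from the `S_D`-invariance of `ψ`,
  `map_rename_depthThreePsi`).
* **`dim 𝓛 = #{monomials of degree d in x_1, …, x_n} = C(n+d−1, d)`** for `d ≤ D`
  (`finrank_entrySpace_depthThreePsi`, `…_eq_choose`; "the coefficients in `y` of each coordinate are
  independent": `linearIndependent_coeff_depthThreePsi`).
* **`dim SSM(y) ≤` the same number** (`finrank_ssmSpace_le`): a set-symmetric multilinear polynomial is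
  determined by one coefficient per value multiset, because `S_D` acts transitively on the transversals
  with a given value multiset (`exists_perm_mapDomain_eq`).
* **`𝓛 = SSM(y)`** for all `n, d, D` (`EGOW2018_sec5_entrySpace_eq_ssmSpace`; both are `0` when `D < d`),
  `dim SSM(y) = C(n+d−1, d)` (`finrank_ssmSpace`), and the corrected form of the displayed isomorphism:
  `x^m ↦ ψ_m` maps the monomial basis of `F[x]_d` to a basis of `SSM(y)` (`EGOW2018_sec5_symmetrization`).

## References

* [EfremenkoGargOliveiraWigderson2018] K. Efremenko, A. Garg, R. Oliveira, A. Wigderson,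
  *Barriers for rank methods in arithmetic complexity*, ITCS 2018, LIPIcs 94, 1:1–1:19;
  arXiv:1710.09502, §5 (pp. 15–16).
-/

noncomputable section

open MvPolynomial Finsupp

namespace Literature.Computability.AlgebraicComplexity

/-! ## Transversal monomials `∏_{i ∈ T} y_{i, g(i)}` and their value profiles -/

section Transversals

variable {D n : ℕ}

/-- **Value profile** of a transversal `(T, g)`, `g : T → [n]`: the multiset of values `{g(i) : i ∈ T}` as
an exponent vector `m ∈ ℕ^n` — the `x`-monomial `x^m = ∏_{i ∈ T} x_{g(i)}` that the `y`-monomial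
`∏_{i ∈ T} y_{i, g(i)}` accompanies in `ψ(y) = Sym_d(∑_j y_{1j} x_j, …)`. [cite: EfremenkoGargOliveiraWigderson2018, §5, p. 15] locator: paper:arxiv-1710.09502 p0015.txt:L49 -/
def valueProfile (T : Finset (Fin D)) (g : T → Fin n) : Fin n →₀ ℕ :=
  ∑ j : T, Finsupp.single (g j) 1

/-- The value profile has degree `|T|`. [cite: EfremenkoGargOliveiraWigderson2018, §5, p. 15] locator: paper:arxiv-1710.09502 p0015.txt:L49 -/
theorem degree_valueProfile (T : Finset (Fin D)) (g : T → Fin n) :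
    (valueProfile T g).degree = T.card := by
  rw [valueProfile, map_sum]
  simp

/-- A transversal monomial over `T` has degree `|T|`. [cite: EfremenkoGargOliveiraWigderson2018, §5, p. 15] locator: paper:arxiv-1710.09502 p0015.txt:L62 -/
theorem degree_transversalMonomial (T : Finset (Fin D)) (g : T → Fin n) :
    (transversalMonomial T g).degree = T.card := by
  rw [transversalMonomial, map_sum]
  simp

/-- The block-degree vector of a transversal monomial over `T` is the indicator of `T` (degree `1` in each
block `y_i`, `i ∈ T`). [cite: EfremenkoGargOliveiraWigderson2018, §5, p. 15] locator: paper:arxiv-1710.09502 p0015.txt:L62 -/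
theorem weight_transversalMonomial (T : Finset (Fin D)) (g : T → Fin n) :
    weight (blockWeight (Prod.fst : Fin D × Fin n → Fin D)) (transversalMonomial T g) =
      blockProfile T := by
  rw [transversalMonomial, map_sum, blockProfile, ← Finset.sum_coe_sort T]
  exact Finset.sum_congr rfl fun j _ => by rw [weight_blockWeight_single]

/-- The value profile in Finset form (for splitting off one block). [cite: EfremenkoGargOliveiraWigderson2018, §5, p. 15] locator: paper:arxiv-1710.09502 p0015.txt:L49 -/
theorem valueProfile_eq_sum_dite (T : Finset (Fin D)) (g : T → Fin n) :
    valueProfile T g = ∑ j ∈ T, if h : j ∈ T then Finsupp.single (g ⟨j, h⟩) 1 else 0 := by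
  rw [valueProfile, ← Finset.sum_coe_sort T]
  refine Finset.sum_congr rfl fun j _ => ?_
  rw [dif_pos j.2]

/-- Entries of a transversal monomial outside its block set vanish. [cite: EfremenkoGargOliveiraWigderson2018, §5, p. 15] locator: paper:arxiv-1710.09502 p0015.txt:L62 -/
theorem transversalMonomial_apply_of_notMem (T : Finset (Fin D)) (g : T → Fin n) {i : Fin D}
    (hi : i ∉ T) (k : Fin n) : transversalMonomial T g (i, k) = 0 := by
  classical
  rw [transversalMonomial, Finsupp.finsetSum_apply]
  refine Finset.sum_eq_zero fun j _ => ?_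
  rw [Finsupp.single_apply, if_neg]
  intro h
  rw [Prod.mk.injEq] at h
  exact hi (h.1 ▸ j.2)

/-- The entry of `∏_{i ∈ T} y_{i, g(i)}` at `y_{j, g(j)}` is `1`. [cite: EfremenkoGargOliveiraWigderson2018, §5, p. 15] locator: paper:arxiv-1710.09502 p0015.txt:L62 -/
theorem transversalMonomial_apply_self (T : Finset (Fin D)) (g : T → Fin n) (j : T) :
    transversalMonomial T g (j, g j) = 1 := by
  classical
  rw [transversalMonomial, Finsupp.finsetSum_apply, Finset.sum_eq_single j]
  · rw [Finsupp.single_eq_same]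
  · intro j' _ hj'
    rw [Finsupp.single_apply, if_neg]
    intro h
    rw [Prod.mk.injEq] at h
    exact hj' (Subtype.ext h.1)
  · intro h
    exact absurd (Finset.mem_univ j) h

/-- The entry of `∏_{i ∈ T} y_{i, g(i)}` at `y_{j, k}`, `k ≠ g(j)`, is `0`. [cite: EfremenkoGargOliveiraWigderson2018, §5, p. 15] locator: paper:arxiv-1710.09502 p0015.txt:L62 -/
theorem transversalMonomial_apply_of_ne (T : Finset (Fin D)) (g : T → Fin n) (j : T) {k : Fin n}
    (hk : g j ≠ k) : transversalMonomial T g (j, k) = 0 := by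
  classical
  rw [transversalMonomial, Finsupp.finsetSum_apply]
  refine Finset.sum_eq_zero fun j' _ => ?_
  rw [Finsupp.single_apply, if_neg]
  intro h
  rw [Prod.mk.injEq] at h
  obtain ⟨h1, h2⟩ := h
  have hjj : j' = j := Subtype.ext h1
  subst hjj
  exact hk h2

/-- For a fixed block set `T`, the transversal monomial determines the choice function `g`. [cite: EfremenkoGargOliveiraWigderson2018, §5, p. 15] locator: paper:arxiv-1710.09502 p0015.txt:L72 -/
theorem transversalMonomial_injective (T : Finset (Fin D)) :
    Function.Injective (transversalMonomial (n := n) T) := by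
  intro g g' h
  funext j
  by_contra hne
  have h1 := transversalMonomial_apply_self T g j
  rw [h, transversalMonomial_apply_of_ne T g' j (fun h' => hne h'.symm)] at h1
  exact zero_ne_one h1

/-- The transversal monomial determines its block set `T`. [cite: EfremenkoGargOliveiraWigderson2018, §5, p. 15] locator: paper:arxiv-1710.09502 p0015.txt:L72 -/
theorem eq_of_transversalMonomial_eq {T T' : Finset (Fin D)} {g : T → Fin n} {g' : T' → Fin n}
    (h : transversalMonomial T g = transversalMonomial T' g') : T = T' := by
  have hw := congrArg (weight (blockWeight (Prod.fst : Fin D × Fin n → Fin D))) h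
  rw [weight_transversalMonomial, weight_transversalMonomial] at hw
  exact blockProfile_injective hw

/-- **Multilinear monomials are transversals:** an exponent vector with degree `≤ 1` in every block `y_i` is
`∏_{i ∈ T} y_{i, g(i)}` for its block set `T` and a choice function `g` (tree
`exists_eq_transversalMonomial`). [cite: EfremenkoGargOliveiraWigderson2018, §5, p. 15] locator: paper:arxiv-1710.09502 p0015.txt:L62 -/
theorem exists_eq_transversalMonomial_of_forall_le_one (e : Fin D × Fin n →₀ ℕ)
    (he : ∀ i, weight (blockWeight (Prod.fst : Fin D × Fin n → Fin D)) e i ≤ 1) :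
    ∃ (T : Finset (Fin D)) (g : T → Fin n), e = transversalMonomial T g := by
  classical
  set w := weight (blockWeight (Prod.fst : Fin D × Fin n → Fin D)) e with hw
  have hprof : w = blockProfile w.support := by
    ext i
    rw [blockProfile_apply]
    split_ifs with hi
    · exact le_antisymm (he i) (Nat.one_le_iff_ne_zero.2 (Finsupp.mem_support_iff.1 hi))
    · exact Finsupp.notMem_support_iff.1 hi
  obtain ⟨g, hg⟩ := exists_eq_transversalMonomial w.support e hprof
  exact ⟨w.support, g, hg⟩

/-- Relabelling the blocks by `σ ∈ S_D` sends `∏_{i ∈ T} y_{i, g(i)}` to `∏_{i ∈ T} y_{σ(i), g(i)}`.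
[cite: EfremenkoGargOliveiraWigderson2018, §5, p. 15] locator: paper:arxiv-1710.09502 p0015.txt:L66 -/
theorem mapDomain_prodMap_transversalMonomial (σ : Equiv.Perm (Fin D)) (T : Finset (Fin D))
    (g : T → Fin n) :
    Finsupp.mapDomain (Prod.map σ id) (transversalMonomial T g) =
      ∑ j : T, Finsupp.single ((σ j : Fin D), g j) 1 := by
  rw [transversalMonomial, Finsupp.mapDomain_finsetSum]
  exact Finset.sum_congr rfl fun j _ => by rw [Finsupp.mapDomain_single]; rfl

/-- The value profile counts, for each value `v`, the blocks `i ∈ T` with `g(i) = v`.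
[cite: EfremenkoGargOliveiraWigderson2018, §5, p. 15] locator: paper:arxiv-1710.09502 p0015.txt:L76 -/
theorem valueProfile_apply (T : Finset (Fin D)) (g : T → Fin n) (v : Fin n) :
    valueProfile T g v = Fintype.card {j : T // g j = v} := by
  classical
  rw [valueProfile, Finsupp.finsetSum_apply]
  simp_rw [Finsupp.single_apply]
  rw [Finset.sum_boole, Fintype.card_subtype]
  simp

/-- **Transitivity of `S_D` on transversals with a given value multiset:** if `(T, g)` and `(T', g')` have
the same value profile, some block permutation `σ` carries `∏_{i ∈ T} y_{i, g(i)}` to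
`∏_{i ∈ T'} y_{i, g'(i)}` (match the fibres of `g` and `g'` value by value, extend to a permutation of
`[D]`). This is the combinatorial content of "the space of homogeneous polynomials is isomorphic to the
space of set symmetric multilinear polynomials" (p. 15). [cite: EfremenkoGargOliveiraWigderson2018, §5, p. 15] locator: paper:arxiv-1710.09502 p0015.txt:L76 -/
theorem exists_perm_mapDomain_eq (T T' : Finset (Fin D)) (g : T → Fin n) (g' : T' → Fin n)
    (h : valueProfile T g = valueProfile T' g') :
    ∃ σ : Equiv.Perm (Fin D),
      Finsupp.mapDomain (Prod.map σ id) (transversalMonomial T g) = transversalMonomial T' g' := by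
  classical
  have hcard : ∀ v : Fin n, Fintype.card {j : T // g j = v} = Fintype.card {j : T' // g' j = v} :=
    fun v => by rw [← valueProfile_apply, ← valueProfile_apply, h]
  let e : ∀ v : Fin n, {j : T // g j = v} ≃ {j : T' // g' j = v} :=
    fun v => Fintype.equivOfCardEq (hcard v)
  let β : T ≃ T' := Equiv.ofFiberEquiv e
  have hβ : ∀ j : T, g' (β j) = g j := fun j => Equiv.ofFiberEquiv_map e j
  refine ⟨β.extendSubtype, ?_⟩
  rw [mapDomain_prodMap_transversalMonomial, transversalMonomial,
    ← Equiv.sum_comp β (fun j' : T' => Finsupp.single ((j' : Fin D), g' j') 1)]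
  refine Finset.sum_congr rfl fun j _ => ?_
  rw [hβ j, Equiv.extendSubtype_apply_of_mem β j.1 j.2]

end Transversals

/-! ## The coordinates `ψ_m` of `ψ` -/

section Coordinates

variable {F : Type*} [Field F] {n D : ℕ}

/-- **Expansion of a product of generic linear forms:** `∏_{i ∈ T} (∑_j y_{ij} x_j) = ∑_{g : T → [n]} (∏_{i ∈ T} y_{i,g(i)}) · x^{m(T,g)}`,
`m(T, g)` the value profile. [cite: EfremenkoGargOliveiraWigderson2018, §5 eq. (5.1), p. 15] locator: paper:arxiv-1710.09502 p0015.txt:L49 -/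
theorem prod_sum_C_X_mul_X_eq (T : Finset (Fin D)) :
    ∏ i ∈ T, (∑ j : Fin n, C (X (i, j)) *
        (X j : MvPolynomial (Fin n) (MvPolynomial (Fin D × Fin n) F))) =
      ∑ g : T → Fin n, monomial (valueProfile T g) (monomial (transversalMonomial T g) 1) := by
  classical
  rw [← Finset.prod_coe_sort T, Fintype.prod_sum]
  refine Finset.sum_congr rfl fun g _ => ?_
  simp_rw [C_mul_X_eq_monomial]
  rw [valueProfile, ← monomial_sum_prod]
  congr 1
  rw [transversalMonomial, monomial_sum_one]
  rfl

/-- **The coordinates of `ψ`:** the `x^m`-coefficient of `ψ(y) = Sym_d(∑_j y_{1j} x_j, …, ∑_j y_{Dj} x_j)` is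
`ψ_m = ∑_{|T| = d} ∑_{g : T → [n], m(T,g) = m} ∏_{i ∈ T} y_{i, g(i)}` — the sum of the transversal `y`-monomials
with value multiset `m` ("the coordinates are indexed by monomials of degree `d` in `x`", p. 15).
[cite: EfremenkoGargOliveiraWigderson2018, §5 eq. (5.1), p. 15] locator: paper:arxiv-1710.09502 p0015.txt:L54 -/
theorem coeff_depthThreePsi (d D : ℕ) (m : Fin n →₀ ℕ) :
    coeff m (depthThreePsi F n d D) =
      ∑ T ∈ (Finset.univ : Finset (Fin D)).powersetCard d, ∑ g : T → Fin n,
        if valueProfile T g = m then monomial (transversalMonomial T g) (1 : F) else 0 := by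
  classical
  rw [depthThreePsi, Finset.esymm_map_val, coeff_sum]
  refine Finset.sum_congr rfl fun T _ => ?_
  rw [prod_sum_C_X_mul_X_eq, coeff_sum]
  refine Finset.sum_congr rfl fun g _ => ?_
  rw [coeff_monomial]

/-- `ψ` is homogeneous of degree `d` in `x`: `ψ_m = 0` unless `deg m = d` (so the paper's functionals on
`F[x]_d` and all functionals on `F[x]` give the same `𝓛`). [cite: EfremenkoGargOliveiraWigderson2018, §5, p. 15] locator: paper:arxiv-1710.09502 p0015.txt:L54 -/
theorem coeff_depthThreePsi_eq_zero {d : ℕ} {m : Fin n →₀ ℕ} (hm : m.degree ≠ d) :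
    coeff m (depthThreePsi F n d D) = 0 := by
  rw [coeff_depthThreePsi]
  refine Finset.sum_eq_zero fun T hT => Finset.sum_eq_zero fun g _ => ?_
  rw [if_neg]
  rintro rfl
  rw [degree_valueProfile, (Finset.mem_powersetCard.1 hT).2] at hm
  exact hm rfl

/-- The `y`-monomials of `ψ_m` are transversals `∏_{i ∈ T} y_{i, g(i)}` with `|T| = d` and value multiset `m`.
[cite: EfremenkoGargOliveiraWigderson2018, §5, p. 15] locator: paper:arxiv-1710.09502 p0015.txt:L62 -/
theorem exists_of_mem_support_coeff_depthThreePsi {d : ℕ} {m : Fin n →₀ ℕ} {e : Fin D × Fin n →₀ ℕ}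
    (he : e ∈ (coeff m (depthThreePsi F n d D)).support) :
    ∃ T ∈ (Finset.univ : Finset (Fin D)).powersetCard d, ∃ g : T → Fin n,
      e = transversalMonomial T g ∧ valueProfile T g = m := by
  classical
  rw [MvPolynomial.mem_support_iff, coeff_depthThreePsi, coeff_sum] at he
  obtain ⟨T, hT, hne⟩ := Finset.exists_ne_zero_of_sum_ne_zero he
  rw [coeff_sum] at hne
  obtain ⟨g, -, hne'⟩ := Finset.exists_ne_zero_of_sum_ne_zero hne
  refine ⟨T, hT, g, ?_⟩
  by_cases hvp : valueProfile T g = m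
  · rw [if_pos hvp, coeff_monomial] at hne'
    by_cases heq : transversalMonomial T g = e
    · exact ⟨heq.symm, hvp⟩
    · exact absurd (if_neg heq) hne'
  · rw [if_neg hvp, coeff_zero] at hne'
    exact absurd rfl hne'

/-- **"the coefficients in `y` of each coordinate are independent"** (p. 15), quantitatively: the
coefficient of the transversal `∏_{i ∈ T} y_{i, g(i)}` (`|T| = d`) in `ψ_{m'}` is `1` if `m(T, g) = m'` and `0`
otherwise — distinct coordinates have disjoint `y`-supports. [cite: EfremenkoGargOliveiraWigderson2018, §5, p. 15] locator: paper:arxiv-1710.09502 p0015.txt:L72 -/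
theorem coeff_transversalMonomial_coeff_depthThreePsi {d : ℕ} (T : Finset (Fin D)) (hT : T.card = d)
    (g : T → Fin n) (m : Fin n →₀ ℕ) :
    coeff (transversalMonomial T g) (coeff m (depthThreePsi F n d D)) =
      if valueProfile T g = m then 1 else 0 := by
  classical
  rw [coeff_depthThreePsi, coeff_sum, Finset.sum_eq_single T]
  · rw [coeff_sum, Fintype.sum_eq_single g]
    · by_cases h : valueProfile T g = m <;> simp [h]
    · intro g' hg'
      split_ifs
      · rw [coeff_monomial, if_neg]
        exact fun h => hg' (transversalMonomial_injective T h)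
      · exact coeff_zero _
  · intro T' _ hT'
    rw [coeff_sum]
    refine Finset.sum_eq_zero fun g' _ => ?_
    split_ifs
    · rw [coeff_monomial, if_neg]
      exact fun h => hT' (eq_of_transversalMonomial_eq h)
    · exact coeff_zero _
  · intro h
    exact absurd (Finset.mem_powersetCard.2 ⟨Finset.subset_univ _, hT⟩) h

/-- **Every degree-`d` monomial is a value profile** when `d ≤ D`: for `m` of degree `d` there is a
transversal `(T, g)`, `|T| = d`, with value multiset `m` (so `ψ_m ≠ 0`). [cite: EfremenkoGargOliveiraWigderson2018, §5, p. 15] locator: paper:arxiv-1710.09502 p0015.txt:L72 -/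
theorem exists_valueProfile_eq {d D : ℕ} (hd : d ≤ D) (m : Fin n →₀ ℕ) (hm : m.degree = d) :
    ∃ (T : Finset (Fin D)) (g : T → Fin n), T.card = d ∧ valueProfile T g = m := by
  classical
  induction d generalizing m with
  | zero =>
    refine ⟨∅, fun j => absurd j.2 (Finset.notMem_empty _), rfl, ?_⟩
    rw [(Finsupp.degree_eq_zero_iff m).1 hm, valueProfile_eq_sum_dite, Finset.sum_empty]
  | succ d ih =>
    have hm0 : m ≠ 0 := by
      rintro rfl
      rw [map_zero] at hm
      exact Nat.succ_ne_zero d hm.symm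
    obtain ⟨a, ha⟩ : ∃ a, a ∈ m.support :=
      Finset.nonempty_iff_ne_empty.2 (by rwa [Ne, Finsupp.support_eq_empty])
    have hle : Finsupp.single a 1 ≤ m :=
      Finsupp.single_le_iff.2 (Nat.one_le_iff_ne_zero.2 (Finsupp.mem_support_iff.1 ha))
    set m' := m - Finsupp.single a 1 with hm'
    have hmm' : m = m' + Finsupp.single a 1 := (tsub_add_cancel_of_le hle).symm
    have hdeg : m'.degree = d := by
      have h2 := congrArg Finsupp.degree hmm'
      rw [map_add, degree_single, hm] at h2
      omega
    obtain ⟨T', g', hT', hvp'⟩ := ih (Nat.le_of_succ_le hd) m' hdeg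
    obtain ⟨i, hi⟩ : ∃ i : Fin D, i ∉ T' := by
      by_contra hall
      push Not at hall
      have hT'u : T' = Finset.univ := Finset.eq_univ_of_forall hall
      rw [hT'u, Finset.card_univ, Fintype.card_fin] at hT'
      omega
    refine ⟨insert i T', fun j => if h : (j : Fin D) = i then a else
      g' ⟨j, (Finset.mem_insert.1 j.2).resolve_left h⟩, ?_, ?_⟩
    · rw [Finset.card_insert_of_notMem hi, hT']
    · rw [hmm', valueProfile_eq_sum_dite, Finset.sum_insert hi,
        dif_pos (Finset.mem_insert_self i T'), dif_pos rfl, add_comm, ← hvp', valueProfile_eq_sum_dite]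
      congr 1
      refine Finset.sum_congr rfl fun j hj => ?_
      have hji : j ≠ i := fun h => hi (h ▸ hj)
      rw [dif_pos hj, dif_pos (Finset.mem_insert_of_mem hj)]
      dsimp only
      rw [dif_neg hji]

/-- **The coordinates `ψ_m`, `deg m = d`, are linearly independent** (`d ≤ D`): "`dim(𝓛)` is equal to the
dimension of the space of homogeneous polynomials of degree `d` over `x`, as we can take the standard
linear functionals corresponding to each coordinate … (and the coefficients in `y` of each coordinate are
independent)" (p. 15). [cite: EfremenkoGargOliveiraWigderson2018, §5, p. 15] locator: paper:arxiv-1710.09502 p0015.txt:L71 -/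
theorem linearIndependent_coeff_depthThreePsi {d D : ℕ} (hd : d ≤ D) :
    LinearIndependent F (fun m : (Finset.univ : Finset (Fin n)).finsuppAntidiag d =>
      coeff (m : Fin n →₀ ℕ) (depthThreePsi F n d D)) := by
  classical
  rw [Fintype.linearIndependent_iff]
  intro c hc m₀
  obtain ⟨T, g, hT, hvp⟩ :=
    exists_valueProfile_eq hd (m₀ : Fin n →₀ ℕ) ((mem_finsuppAntidiag_univ_iff _).1 m₀.2)
  have h := congrArg (coeff (transversalMonomial T g)) hc
  rw [coeff_sum, coeff_zero, Finset.sum_eq_single m₀] at h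
  · rwa [coeff_smul, coeff_transversalMonomial_coeff_depthThreePsi T hT g, if_pos hvp,
      smul_eq_mul, mul_one] at h
  · intro m _ hm
    rw [coeff_smul, coeff_transversalMonomial_coeff_depthThreePsi T hT g, hvp, if_neg, smul_zero]
    exact fun h' => hm (Subtype.ext h'.symm)
  · intro h'
    exact absurd (Finset.mem_univ _) h'

end Coordinates

/-! ## `SSM(y)`: set-symmetric multilinear polynomials of degree `d` -/

section SSM

variable {F : Type*} [Field F] {n D : ℕ}

/-- **Multilinear with respect to the blocks `y = (y_1, …, y_D)`**, `y_i = (y_{i1}, …, y_{in})`: every monomial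
has degree `≤ 1` in each block ("any `ℓ(ψ)` is a set multilinear function in `y = (y_1, …, y_D)`", p. 15;
for degree `d < D` only `d` of the blocks occur in each monomial). [cite: EfremenkoGargOliveiraWigderson2018, §5, p. 15] locator: paper:arxiv-1710.09502 p0015.txt:L62 -/
def IsBlockMultilinear (p : MvPolynomial (Fin D × Fin n) F) : Prop :=
  ∀ e ∈ p.support, ∀ i : Fin D, weight (blockWeight (Prod.fst : Fin D × Fin n → Fin D)) e i ≤ 1

/-- **Set-symmetric:** invariant under permuting the blocks, `p(y_1, …, y_D) = p(y_{σ(1)}, …, y_{σ(D)})` for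
all `σ ∈ S_D` (the relabelling `y_{ij} ↦ y_{σ(i) j}` is `rename (Prod.map σ id)`). [cite: EfremenkoGargOliveiraWigderson2018, §5, p. 15] locator: paper:arxiv-1710.09502 p0015.txt:L64 -/
def IsBlockSymmetric (p : MvPolynomial (Fin D × Fin n) F) : Prop :=
  ∀ σ : Equiv.Perm (Fin D), rename (Prod.map σ id) p = p

variable (F n) in
/-- **`SSM(y)`**, "the space of set symmetric multilinear polynomials of degree `d` in the variables `y`"
(p. 15): homogeneous of degree `d`, block-multilinear and block-symmetric polynomials in
`y = (y_{ij})_{i ∈ [D], j ∈ [n]}`, as a subspace of `F[y]`. [cite: EfremenkoGargOliveiraWigderson2018, §5, p. 15] locator: paper:arxiv-1710.09502 p0015.txt:L60 -/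
def ssmSpace (d D : ℕ) : Submodule F (MvPolynomial (Fin D × Fin n) F) where
  carrier := {p | p.IsHomogeneous d ∧ IsBlockMultilinear p ∧ IsBlockSymmetric p}
  zero_mem' := ⟨isHomogeneous_zero _ _ _, fun e he => by simp at he, fun σ => map_zero _⟩
  add_mem' := by
    rintro p q ⟨hp1, hp2, hp3⟩ ⟨hq1, hq2, hq3⟩
    refine ⟨hp1.add hq1, fun e he i => ?_, fun σ => by rw [map_add, hp3 σ, hq3 σ]⟩
    rcases Finset.mem_union.1 (MvPolynomial.support_add he) with h | h
    · exact hp2 e h i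
    · exact hq2 e h i
  smul_mem' := by
    rintro c p ⟨hp1, hp2, hp3⟩
    refine ⟨?_, fun e he i => hp2 e (MvPolynomial.support_smul he) i, fun σ => ?_⟩
    · rw [smul_eq_C_mul]
      exact hp1.C_mul c
    · rw [smul_eq_C_mul, map_mul, rename_C, hp3 σ]

/-- Membership in `SSM(y)`. [cite: EfremenkoGargOliveiraWigderson2018, §5, p. 15] locator: paper:arxiv-1710.09502 p0015.txt:L60 -/
theorem mem_ssmSpace_iff {d : ℕ} {p : MvPolynomial (Fin D × Fin n) F} :
    p ∈ ssmSpace F n d D ↔ p.IsHomogeneous d ∧ IsBlockMultilinear p ∧ IsBlockSymmetric p :=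
  Iff.rfl

/-- The monomials of a member of `SSM(y)` are transversals `∏_{i ∈ T} y_{i, g(i)}` with `|T| = d`.
[cite: EfremenkoGargOliveiraWigderson2018, §5, p. 15] locator: paper:arxiv-1710.09502 p0015.txt:L62 -/
theorem exists_eq_transversalMonomial_of_mem_ssmSpace {d : ℕ} {p : MvPolynomial (Fin D × Fin n) F}
    (hp : p ∈ ssmSpace F n d D) {e : Fin D × Fin n →₀ ℕ} (he : e ∈ p.support) :
    ∃ (T : Finset (Fin D)) (g : T → Fin n), T.card = d ∧ e = transversalMonomial T g := by
  obtain ⟨T, g, rfl⟩ := exists_eq_transversalMonomial_of_forall_le_one e (hp.2.1 e he)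
  refine ⟨T, g, ?_, rfl⟩
  have h := hp.1 (MvPolynomial.mem_support_iff.1 he)
  rw [← degree_transversalMonomial T g, Finsupp.degree_eq_weight_one]
  exact h

/-- For a block-symmetric `p`, relabelling the blocks does not change coefficients.
[cite: EfremenkoGargOliveiraWigderson2018, §5, p. 15] locator: paper:arxiv-1710.09502 p0015.txt:L66 -/
theorem coeff_mapDomain_of_isBlockSymmetric {p : MvPolynomial (Fin D × Fin n) F}
    (hp : IsBlockSymmetric p) (σ : Equiv.Perm (Fin D)) (e : Fin D × Fin n →₀ ℕ) :
    coeff (Finsupp.mapDomain (Prod.map σ id) e) p = coeff e p := by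
  conv_lhs => rw [← hp σ]
  exact coeff_rename_mapDomain _ (σ.injective.prodMap Function.injective_id) p e

/-- `SSM(y) = 0` when `D < d` (a multilinear monomial of degree `d` needs `d` distinct blocks).
[cite: EfremenkoGargOliveiraWigderson2018, §5, p. 15] locator: paper:arxiv-1710.09502 p0015.txt:L60 -/
theorem ssmSpace_eq_bot_of_lt {d : ℕ} (h : D < d) : ssmSpace F n d D = ⊥ := by
  rw [Submodule.eq_bot_iff]
  intro p hp
  by_contra hne
  obtain ⟨e, he⟩ := MvPolynomial.support_nonempty.2 hne
  obtain ⟨T, g, hT, -⟩ := exists_eq_transversalMonomial_of_mem_ssmSpace hp he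
  have hle := Finset.card_le_univ T
  rw [Fintype.card_fin, hT] at hle
  omega

/-- **`S_D`-invariance of `ψ`:** relabelling the blocks permutes the linear forms `∑_j y_{ij} x_j` and fixes
their elementary symmetric polynomial ("since `Sym` (and therefore `ψ` and `ℓ(ψ)`) has this property",
p. 15). [cite: EfremenkoGargOliveiraWigderson2018, §5, p. 15] locator: paper:arxiv-1710.09502 p0015.txt:L66 -/
theorem map_rename_depthThreePsi (d D : ℕ) (σ : Equiv.Perm (Fin D)) :
    MvPolynomial.map (rename (Prod.map σ id) :
        MvPolynomial (Fin D × Fin n) F →ₐ[F] MvPolynomial (Fin D × Fin n) F).toRingHom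
      (depthThreePsi F n d D) = depthThreePsi F n d D := by
  classical
  set Lf : Fin D → MvPolynomial (Fin n) (MvPolynomial (Fin D × Fin n) F) :=
    fun i => ∑ j : Fin n, C (X (i, j)) * X j with hLf
  have hL : ∀ i : Fin D,
      MvPolynomial.map (rename (Prod.map σ id) :
        MvPolynomial (Fin D × Fin n) F →ₐ[F] MvPolynomial (Fin D × Fin n) F).toRingHom (Lf i) =
        Lf (σ i) := by
    intro i
    rw [hLf]
    dsimp only
    rw [map_sum]
    refine Finset.sum_congr rfl fun j _ => ?_
    rw [map_mul, map_C, map_X, AlgHom.toRingHom_eq_coe, RingHom.coe_coe, rename_X]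
    rfl
  have hψ : depthThreePsi F n d D =
      ∑ T ∈ (Finset.univ : Finset (Fin D)).powersetCard d, ∏ i ∈ T, Lf i := by
    rw [depthThreePsi, Finset.esymm_map_val]
  rw [hψ, map_sum]
  simp_rw [map_prod, hL]
  have hre : ∀ T : Finset (Fin D), ∏ i ∈ T, Lf (σ i) = ∏ i ∈ T.map σ.toEmbedding, Lf i :=
    fun T => (Finset.prod_map T σ.toEmbedding Lf).symm
  simp_rw [hre]
  have hsum : ∑ T ∈ (Finset.univ : Finset (Fin D)).powersetCard d, ∏ i ∈ T.map σ.toEmbedding, Lf i =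
      ∑ T ∈ ((Finset.univ : Finset (Fin D)).powersetCard d).map
        (Finset.mapEmbedding σ.toEmbedding).toEmbedding, ∏ i ∈ T, Lf i := by
    rw [Finset.sum_map]
    rfl
  rw [hsum, ← Finset.powersetCard_map, Finset.map_univ_equiv]

/-- **`𝓛 ⊆ SSM(y)`, coordinate-wise:** each coordinate `ψ_m` is homogeneous of degree `d`, multilinear in the
blocks and set-symmetric. [cite: EfremenkoGargOliveiraWigderson2018, §5, p. 15] locator: paper:arxiv-1710.09502 p0015.txt:L62 -/
theorem coeff_depthThreePsi_mem_ssmSpace (d D : ℕ) (m : Fin n →₀ ℕ) :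
    coeff m (depthThreePsi F n d D) ∈ ssmSpace F n d D := by
  classical
  refine ⟨?_, ?_, ?_⟩
  · rw [coeff_depthThreePsi]
    refine IsHomogeneous.sum _ _ _ fun T hT => IsHomogeneous.sum _ _ _ fun g _ => ?_
    split_ifs
    · exact isHomogeneous_monomial _
        (by rw [degree_transversalMonomial, (Finset.mem_powersetCard.1 hT).2])
    · exact isHomogeneous_zero _ _ _
  · intro e he i
    obtain ⟨T, -, g, rfl, -⟩ := exists_of_mem_support_coeff_depthThreePsi he
    rw [weight_transversalMonomial, blockProfile_apply]
    split_ifs <;> simp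
  · intro σ
    have h := congrArg (coeff m) (map_rename_depthThreePsi (F := F) (n := n) d D σ)
    rw [coeff_map] at h
    exact h

/-- **EGOW 2018 §5, "`𝓛 ⊆ SSM(y)`"** (p. 15): every entry `ℓ(ψ)` of the depth-3 symbolic matrices is a
set-symmetric multilinear polynomial of degree `d` in `y`. [cite: EfremenkoGargOliveiraWigderson2018, §5, p. 15] locator: paper:arxiv-1710.09502 p0015.txt:L69 -/
theorem entrySpace_depthThreePsi_le_ssmSpace (d D : ℕ) :
    entrySpace (depthThreePsi F n d D) ≤ ssmSpace F n d D := by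
  rw [entrySpace_eq_span_coeff]
  refine Submodule.span_le.2 ?_
  rintro _ ⟨m, rfl⟩
  exact coeff_depthThreePsi_mem_ssmSpace d D m

/-- `𝓛` is spanned by the coordinates `ψ_m` of degree exactly `d`. [cite: EfremenkoGargOliveiraWigderson2018, §5, p. 15] locator: paper:arxiv-1710.09502 p0015.txt:L71 -/
theorem entrySpace_depthThreePsi_eq_span (d D : ℕ) :
    entrySpace (depthThreePsi F n d D) =
      Submodule.span F (Set.range fun m : (Finset.univ : Finset (Fin n)).finsuppAntidiag d =>
        coeff (m : Fin n →₀ ℕ) (depthThreePsi F n d D)) := by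
  rw [entrySpace_eq_span_coeff]
  refine le_antisymm (Submodule.span_le.2 ?_) (Submodule.span_mono ?_)
  · rintro _ ⟨m, rfl⟩
    by_cases hm : m.degree = d
    · exact Submodule.subset_span ⟨⟨m, (mem_finsuppAntidiag_univ_iff _).2 hm⟩, rfl⟩
    · change coeff m (depthThreePsi F n d D) ∈ _
      rw [coeff_depthThreePsi_eq_zero hm]
      exact Submodule.zero_mem _
  · rintro _ ⟨m, rfl⟩
    exact ⟨m, rfl⟩

/-- **`dim 𝓛 = #{monomials of degree d in x}`** for `d ≤ D` (p. 15: "`dim(𝓛)` is equal to the dimension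
of the space of homogeneous polynomials of degree `d` over `x`"). [cite: EfremenkoGargOliveiraWigderson2018, §5, p. 15] locator: paper:arxiv-1710.09502 p0015.txt:L71 -/
theorem finrank_entrySpace_depthThreePsi {d : ℕ} (hd : d ≤ D) :
    Module.finrank F (entrySpace (depthThreePsi F n d D)) =
      ((Finset.univ : Finset (Fin n)).finsuppAntidiag d).card := by
  rw [entrySpace_depthThreePsi_eq_span, finrank_span_eq_card (linearIndependent_coeff_depthThreePsi hd),
    Fintype.card_coe]

/-- The same count as a binomial coefficient: `dim 𝓛 = C(n+d−1, d)` (`d ≤ D`). [cite: EfremenkoGargOliveiraWigderson2018, §5, p. 15] locator: paper:arxiv-1710.09502 p0015.txt:L71 -/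
theorem finrank_entrySpace_depthThreePsi_eq_choose {d : ℕ} (hd : d ≤ D) :
    Module.finrank F (entrySpace (depthThreePsi F n d D)) = (n + d - 1).choose d := by
  rw [finrank_entrySpace_depthThreePsi hd, Finset.card_finsuppAntidiag_nat_eq_choose, Finset.card_univ,
    Fintype.card_fin]

/-- **`dim SSM(y) ≤ #{monomials of degree d in x}`** (`d ≤ D`), and `SSM(y)` is finite-dimensional: a
set-symmetric multilinear polynomial is determined by one coefficient per value multiset, by the
transitivity `exists_perm_mapDomain_eq`. [cite: EfremenkoGargOliveiraWigderson2018, §5, p. 15] locator: paper:arxiv-1710.09502 p0015.txt:L75 -/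
theorem finrank_ssmSpace_le {d : ℕ} (hd : d ≤ D) :
    FiniteDimensional F (ssmSpace F n d D) ∧
      Module.finrank F (ssmSpace F n d D) ≤ ((Finset.univ : Finset (Fin n)).finsuppAntidiag d).card := by
  classical
  set A := (Finset.univ : Finset (Fin n)).finsuppAntidiag d with hA
  have hex : ∀ m : A, ∃ Tg : Σ T : Finset (Fin D), (T → Fin n),
      Tg.1.card = d ∧ valueProfile Tg.1 Tg.2 = (m : Fin n →₀ ℕ) := fun m => by
    obtain ⟨T, g, h1, h2⟩ := exists_valueProfile_eq hd (m : Fin n →₀ ℕ)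
      ((mem_finsuppAntidiag_univ_iff _).1 m.2)
    exact ⟨⟨T, g⟩, h1, h2⟩
  choose Tg hTg using hex
  let Φ : MvPolynomial (Fin D × Fin n) F →ₗ[F] (A → F) :=
    LinearMap.pi fun m => lcoeff F (transversalMonomial (Tg m).1 (Tg m).2)
  have hinj : Function.Injective (Φ.comp (ssmSpace F n d D).subtype) := by
    rw [← LinearMap.ker_eq_bot, LinearMap.ker_eq_bot']
    rintro ⟨p, hp⟩ h0
    have hΦ : ∀ m : A, coeff (transversalMonomial (Tg m).1 (Tg m).2) p = 0 := fun m => by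
      have := congrFun h0 m
      simpa [Φ] using this
    have key : ∀ e, coeff e p = 0 := by
      intro e
      by_contra hne
      have he : e ∈ p.support := MvPolynomial.mem_support_iff.2 hne
      obtain ⟨T, g, hT, rfl⟩ := exists_eq_transversalMonomial_of_mem_ssmSpace hp he
      let m : A := ⟨valueProfile T g, (mem_finsuppAntidiag_univ_iff _).2 (by rw [degree_valueProfile, hT])⟩
      obtain ⟨σ, hσ⟩ := exists_perm_mapDomain_eq T (Tg m).1 g (Tg m).2 (hTg m).2.symm
      have h1 := hΦ m
      rw [← hσ, coeff_mapDomain_of_isBlockSymmetric hp.2.2] at h1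
      exact hne h1
    exact Subtype.ext (MvPolynomial.ext _ _ fun e => by rw [key e]; rfl)
  haveI : FiniteDimensional F (ssmSpace F n d D) := FiniteDimensional.of_injective _ hinj
  refine ⟨this, ?_⟩
  calc Module.finrank F (ssmSpace F n d D) ≤ Module.finrank F (A → F) :=
        LinearMap.finrank_le_finrank_of_injective hinj
    _ = A.card := by rw [Module.finrank_fintype_fun_eq_card, Fintype.card_coe]

/-- **EGOW 2018 §5, the claim `𝓛 = SSM(y)`** (p. 15): the space of possible entries of the depth-3
symbolic matrices `L(ψ)` is exactly the space of set-symmetric multilinear polynomials of degree `d` in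
`y` — for all `n`, `d`, `D` (both sides are `0` when `D < d`). Proof as printed: `𝓛 ⊆ SSM(y)` and
`dim SSM(y) ≤ dim 𝓛`. [cite: EfremenkoGargOliveiraWigderson2018, §5, p. 15] locator: paper:arxiv-1710.09502 p0015.txt:L58 -/
theorem EGOW2018_sec5_entrySpace_eq_ssmSpace (d D : ℕ) :
    entrySpace (depthThreePsi F n d D) = ssmSpace F n d D := by
  rcases le_or_gt d D with hd | hd
  · haveI := (finrank_ssmSpace_le (F := F) (n := n) hd).1
    exact Submodule.eq_of_le_of_finrank_le (entrySpace_depthThreePsi_le_ssmSpace d D)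
      (by rw [finrank_entrySpace_depthThreePsi hd]; exact (finrank_ssmSpace_le hd).2)
  · have h := entrySpace_depthThreePsi_le_ssmSpace (F := F) (n := n) d D
    rw [ssmSpace_eq_bot_of_lt hd] at h ⊢
    exact le_bot_iff.1 h

/-- **`dim SSM(y) = C(n+d−1, d)`** (`d ≤ D`), the dimension of the degree-`d` forms in `x_1, …, x_n`.
[cite: EfremenkoGargOliveiraWigderson2018, §5, p. 15] locator: paper:arxiv-1710.09502 p0015.txt:L70 -/
theorem finrank_ssmSpace {d : ℕ} (hd : d ≤ D) :
    Module.finrank F (ssmSpace F n d D) = (n + d - 1).choose d := by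
  rw [← EGOW2018_sec5_entrySpace_eq_ssmSpace, finrank_entrySpace_depthThreePsi_eq_choose hd]

/-- **The symmetrisation isomorphism, corrected** (p. 15, displayed map): for `d ≤ D`, `x^m ↦ ψ_m` — the sum
of the transversal monomials `∏_{i ∈ T} y_{i, g(i)}`, `|T| = d`, whose value multiset `{g(i)}` is `m` — sends the
monomial basis of the degree-`d` forms in `x` to a BASIS of `SSM(y)`: the `ψ_m` are linearly independent
and span `SSM(y)`. (The print displays `x_{i_1} ⋯ x_{i_d} ↦ ∑_{σ ∈ S_n} ∏_j x_{σ(i_j)}`, which is garbled; this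
is the intended statement.) [cite: EfremenkoGargOliveiraWigderson2018, §5, p. 15] locator: paper:arxiv-1710.09502 p0015.txt:L76 -/
theorem EGOW2018_sec5_symmetrization {d : ℕ} (hd : d ≤ D) :
    LinearIndependent F (fun m : (Finset.univ : Finset (Fin n)).finsuppAntidiag d =>
        coeff (m : Fin n →₀ ℕ) (depthThreePsi F n d D)) ∧
      Submodule.span F (Set.range fun m : (Finset.univ : Finset (Fin n)).finsuppAntidiag d =>
        coeff (m : Fin n →₀ ℕ) (depthThreePsi F n d D)) = ssmSpace F n d D :=
  ⟨linearIndependent_coeff_depthThreePsi hd,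
    by rw [← entrySpace_depthThreePsi_eq_span, EGOW2018_sec5_entrySpace_eq_ssmSpace]⟩

end SSM

end Literature.Computability.AlgebraicComplexity
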